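import Summits.QuantumFields.YangMills.Theorems.FradkinShenkerFlowSusceptibilityToPoincareLinkSetPoincare
import Summits.QuantumFields.YangMills.Theorems.FradkinShenkerFlowSusceptibilityToPoincarePinnedClusterBound
import Summits.QuantumFields.YangMills.Theorems.FradkinShenkerFlowSusceptibilityToPoincareFreeClusterTail
import Summits.QuantumFields.YangMills.Theorems.FradkinShenkerFlowSusceptibilityToPoincarePlantedTerminal
import Summits.QuantumFields.YangMills.Theorems.FradkinShenkerFlowSusceptibilityToPoincareElitzurBessel
import Summits.QuantumFields.YangMills.Theorems.SusceptibilityToPoincare.Negative.TwistSectorSimplyConnected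
import Literature.MathematicalPhysics.QuantumFieldTheory.TwistSectorInputs

/-!
# Line `planted-link-pinning`: its two non-provable stubs are false MODULO the twist-sector inputs

Negative-side support for crux `stmt-QuantumFields-9441`
(`Summit.QuantumFields.YangMills.Theses.FradkinShenkerFlow.SusceptibilityToPoincare`, FS ⇒ UP), line
`planted-link-pinning`, lead's reshaped skeleton `Cruxes/SusceptibilityToPoincare/Lines/…` (sha 321c414b; stubs S1 closed,
S2 `stub_elitzurBessel` p99498, S3c `stub_linkSetPoincare` p97050, S3d `stub_pinnedClusterBound` p100089,
S3e `stub_freeClusterTail`, S3f `stub_plantedTerminal` LANDED; S4 `stub_plantedLocalToGlobal` OPEN; S5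
`stub_centrelessResidual` sentinel).  With S1–S3 theorems, the composition pins the crux on S4 (π₁(G) = 0) and S5
(π₁(G) ≠ 0) alone, and this file records, kernel-checked, that BOTH are false AS TYPED modulo the standing conditional
inputs of the crux's disprovers — so the line cannot close the crux as typed, for the same reason the crux itself is
believed misstated:

* `stub_plantedLocalToGlobal_false_of_twistInputsSU2` — `SimplyConnectedSpace SU(2)` and the SU(2) twist inputs `hW` of
  `Negative/TwistSectorSimplyConnected.lean` (drefute p77766: FS at some admissible `(r, β ≥ 0)` of `SU(2)` — intended
  `r = ρ_{1/2} ⊕ ρ₁^{⊕k}` in phase II of the Bhanot–Creutz plane — together with gauge-invariant measurable events of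
  non-degenerate Wilson mass and vanishing single-link heat-bath flux) refute S4 VERBATIM: S4, fed with the landed
  Elitzur–Bessel anchor (S2) and FS, gives the planted local-to-global inequality, the landed planted terminal inequality
  (S3 = `stub_plantedTerminal` ∘ S3c ∘ S3d ∘ S3e, = `plantedTerminal_holds` p104334) turns it into UP_inv at `(SU(2), r, β)`, and the invariant bottleneck
  (`Negative.not_invariantHeatBathPoincare_of_invariantBottleneck`) forbids UP_inv there.
* `stub_centrelessResidual_false_of_twistSectorInputs` — the sentinel S5 (FS ⇒ UP_inv for `¬ SimplyConnectedSpace G`)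
  is false modulo `Literature.MathematicalPhysics.QuantumFieldTheory.TwistSectorInputs` (cdisprove p76563), exactly as
  the orbit-slice sentinel 4b (`Negative/FalseOfTwistSectorInputs.lean`).

Repair recorded for the planner (misses both witnesses, leaves S1–S3 verbatim): re-type the crux — and with it S4 — as
`IsCompactSimpleLieGroup G → SimplyConnectedSpace G → ∀ r, ∃ β₁, ∀ β ≥ β₁, FS r β → UP r β` (the route's `closes`
absorbs `β₁` by `max β₀ β₁`).  Nothing here asserts a Theses statement or a stub positively.
-/

noncomputable section

namespace Summit.QuantumFields.YangMills.Theorems.SusceptibilityToPoincare.Negative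

open MeasureTheory ProbabilityTheory Filter Topology
open Literature.MathematicalPhysics.QuantumFieldTheory

/-- **S4 `stub_plantedLocalToGlobal` (verbatim, skeleton sha 321c414b) is false modulo the SU(2) twist inputs.**
If `SU(2)` is simply connected (true; not yet in the tree) and the SU(2) twist inputs of
`Negative/TwistSectorSimplyConnected.lean` hold (FS at some faithful unitary `r` and `β ≥ 0` together with gauge-invariant
events of mass in `[δ, 1−δ]` and vanishing heat-bath flux), then the planted local-to-global stub fails: with the landed
S2 (`stub_elitzurBessel`) and S3 (`stub_plantedTerminal` fed with S3c, S3d, S3e; = `plantedTerminal_holds`, p104334) it would give UP_inv at the witness, contradicting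
`not_invariantHeatBathPoincare_of_invariantBottleneck`. [folklore] -/
theorem stub_plantedLocalToGlobal_false_of_twistInputsSU2
    (hSC : SimplyConnectedSpace (Matrix.specialUnitaryGroup (Fin 2) ℂ))
    (hW : ∃ (r : LatticeRep (Matrix.specialUnitaryGroup (Fin 2) ℂ)) (β : ℝ), 0 ≤ β ∧
      (∀ A B : YMSpecies (Matrix.specialUnitaryGroup (Fin 2) ℂ), ∃ χ : ℝ, ∀ S : ℕ,
        ∑ x ∈ Literature.Probability.LatticeModels.box 4 S,
        |covariance (fun U => A.F (Literature.MathematicalPhysics.QuantumLattice.torusLift (2 * S + 1) U))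
          (fun U => B.F (Literature.MathematicalPhysics.QuantumLattice.configShift (-x)
          (Literature.MathematicalPhysics.QuantumLattice.torusLift (2 * S + 1) U)))
          (wilsonMeasure (d := 4) (L := 2 * S + 1) r.ρ β)| ≤ χ) ∧
      ∃ δ : ℝ, 0 < δ ∧ ∃ A : (∀ S : ℕ, Set (GaugeConfig 4 (2 * S + 1) (Matrix.specialUnitaryGroup (Fin 2) ℂ))),
        (∀ S, MeasurableSet (A S)) ∧
        (∀ S, IsGaugeInvariant ((A S).indicator
          (1 : GaugeConfig 4 (2 * S + 1) (Matrix.specialUnitaryGroup (Fin 2) ℂ) → ℝ))) ∧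
        (∀ S, δ ≤ (wilsonMeasure (d := 4) (L := 2 * S + 1) r.ρ β).real (A S) ∧
          (wilsonMeasure (d := 4) (L := 2 * S + 1) r.ρ β).real (A S) ≤ 1 - δ) ∧
        Tendsto (fun S : ℕ => ∑ ℓ : Edge 4 (2 * S + 1), ∫ U, ∫ g,
            ((A S).indicator (1 : GaugeConfig 4 (2 * S + 1) (Matrix.specialUnitaryGroup (Fin 2) ℂ) → ℝ) U -
              (A S).indicator 1 (Function.update U ℓ g)) ^ 2
          ∂((haarProbability (Matrix.specialUnitaryGroup (Fin 2) ℂ)).tilted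
              (fun g' => -β * wilsonAction r.ρ (Function.update U ℓ g')))
          ∂(wilsonMeasure (d := 4) (L := 2 * S + 1) r.ρ β)) atTop (𝓝 0)) :
    ¬ (∀ (G : Type) [Group G] [TopologicalSpace G] [IsTopologicalGroup G] [CompactSpace G]
      [MeasurableSpace G] [BorelSpace G], IsCompactSimpleLieGroup G → SimplyConnectedSpace G →
      ∀ (r : LatticeRep G) (β : ℝ), 0 ≤ β →
      (∀ (S : ℕ), 1 ≤ S → ∀ (μW : Measure (GaugeConfig 4 (2 * S + 1) G)),
        μW = (wilsonMeasure r.ρ β : Measure (GaugeConfig 4 (2 * S + 1) G)) →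
        ∀ φ : GaugeConfig 4 (2 * S + 1) G → ℝ, Measurable φ → (∃ M : ℝ, ∀ U, |φ U| ≤ M) →
        ∑ ℓ : Edge 4 (2 * S + 1),
            variance (μW[φ | MeasurableSpace.comap (fun V : GaugeConfig 4 (2 * S + 1) G => V ℓ) inferInstance]) μW ≤
          variance φ μW) →
      (∀ A B : YMSpecies G, ∃ χ : ℝ, ∀ S : ℕ, ∑ x ∈ Literature.Probability.LatticeModels.box 4 S,
        |covariance (fun U => A.F (Literature.MathematicalPhysics.QuantumLattice.torusLift (2 * S + 1) U))
          (fun U => B.F (Literature.MathematicalPhysics.QuantumLattice.configShift (-x)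
          (Literature.MathematicalPhysics.QuantumLattice.torusLift (2 * S + 1) U)))
          (wilsonMeasure r.ρ β : Measure (GaugeConfig 4 (2 * S + 1) G))| ≤ χ) →
      ∀ ε₀ : ℝ, 0 < ε₀ → ∃ ε : ℝ, 0 < ε ∧ ε ≤ ε₀ ∧ ∃ C : ℝ, 0 ≤ C ∧
        ∀ (S : ℕ) (μW : Measure (GaugeConfig 4 (2 * S + 1) G)),
        μW = (wilsonMeasure r.ρ β : Measure (GaugeConfig 4 (2 * S + 1) G)) →
        ∀ (F : GaugeConfig 4 (2 * S + 1) G → ℝ), Measurable F → (∃ M : ℝ, ∀ U, |F U| ≤ M) →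
        IsGaugeInvariant F →
        variance F μW ≤
          C * ∑ Λ : Finset (Edge 4 (2 * S + 1)),
            ε ^ (Fintype.card (Edge 4 (2 * S + 1)) - Λ.card) * (1 - ε) ^ Λ.card *
              ∫ U, condVar (⨆ ℓ ∈ Λ, MeasurableSpace.comap (fun V : GaugeConfig 4 (2 * S + 1) G => V ℓ) inferInstance)
                F μW U ∂μW) := by
  intro hstub
  obtain ⟨r, β, hβ, hFS, δ, hδ, A, hmeas, hinv, hmass, hflux⟩ := hW
  -- S2 (landed) supplies the Elitzur–Bessel anchor; S4 then gives the planted local-to-global inequality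
  have h4 := hstub (Matrix.specialUnitaryGroup (Fin 2) ℂ) isCompactSimpleLieGroup_su2 hSC r β hβ
    (fun S hS μW hμ φ hφ hb => stub_elitzurBessel (Matrix.specialUnitaryGroup (Fin 2) ℂ) r β S hS μW hμ φ hφ hb) hFS
  -- S3 (landed) is the planted terminal inequality
  obtain ⟨ε₀, hε₀, -, hT⟩ := stub_plantedTerminal (Matrix.specialUnitaryGroup (Fin 2) ℂ) r β
    (stub_linkSetPoincare _ r β) (stub_pinnedClusterBound _ r β) stub_freeClusterTail
  obtain ⟨ε, hε, hεε₀, CM, hCM, hM⟩ := h4 ε₀ hε₀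
  obtain ⟨CT, -, hCT⟩ := hT ε hε hεε₀
  -- together: UP_inv at the witness, which the invariant bottleneck forbids
  refine not_invariantHeatBathPoincare_of_invariantBottleneck r β hδ A hmeas hinv hmass hflux ⟨CM * CT, ?_⟩
  intro S F hF hbd hI
  have h1 := hM S _ rfl F hF hbd hI
  have h2 := hCT S _ rfl F hF hbd
  calc variance F (wilsonMeasure (d := 4) (L := 2 * S + 1) r.ρ β)
      ≤ CM * _ := h1
    _ ≤ CM * (CT * _) := mul_le_mul_of_nonneg_left h2 hCM
    _ = CM * CT * _ := by ring

/-- **S5 `stub_centrelessResidual` (verbatim, skeleton sha 321c414b) is false modulo `TwistSectorInputs`.**  The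
sentinel "FS ⇒ UP_inv for compact simple `G` with `π₁(G) ≠ 0`" fails as soon as some such `G` carries gauge-invariant
events of non-degenerate Wilson mass with vanishing single-link heat-bath flux at a coupling where FS holds
(`Literature.MathematicalPhysics.QuantumFieldTheory.TwistSectorInputs`, the 't Hooft twist sectors of SO(3)₄; cdisprove
p76563): the invariant bottleneck applies verbatim. [folklore] -/
theorem stub_centrelessResidual_false_of_twistSectorInputs :
    Literature.MathematicalPhysics.QuantumFieldTheory.TwistSectorInputs →
    ¬ (∀ (G : Type) [Group G] [TopologicalSpace G] [IsTopologicalGroup G] [CompactSpace G]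
      [MeasurableSpace G] [BorelSpace G], IsCompactSimpleLieGroup G → ¬ SimplyConnectedSpace G →
      ∀ (r : LatticeRep G) (β : ℝ), 0 ≤ β →
      (∀ A B : YMSpecies G, ∃ χ : ℝ, ∀ S : ℕ, ∑ x ∈ Literature.Probability.LatticeModels.box 4 S,
        |covariance (fun U => A.F (Literature.MathematicalPhysics.QuantumLattice.torusLift (2 * S + 1) U))
          (fun U => B.F (Literature.MathematicalPhysics.QuantumLattice.configShift (-x)
          (Literature.MathematicalPhysics.QuantumLattice.torusLift (2 * S + 1) U)))
          (wilsonMeasure r.ρ β : Measure (GaugeConfig 4 (2 * S + 1) G))| ≤ χ) →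
      ∃ C : ℝ, ∀ (S : ℕ) (μW : Measure (GaugeConfig 4 (2 * S + 1) G)),
        μW = (wilsonMeasure r.ρ β : Measure (GaugeConfig 4 (2 * S + 1) G)) →
        ∀ (F : GaugeConfig 4 (2 * S + 1) G → ℝ), Measurable F → (∃ M : ℝ, ∀ U, |F U| ≤ M) →
        IsGaugeInvariant F →
        variance F μW ≤
          C * ∑ ℓ : Edge 4 (2 * S + 1), ∫ U, ∫ g, (F U - F (Function.update U ℓ g)) ^ 2
            ∂((haarProbability G).tilted (fun g' => -β * wilsonAction r.ρ (Function.update U ℓ g'))) ∂μW) := by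
  intro h hstub
  obtain ⟨G, _, _, _, _, _, _, hsimple, hnsc, r, β, hβ, hfs, δ, hδ, A, hmeas, hinv, hmass, hflux⟩ := h
  obtain ⟨C, hC⟩ := hstub G hsimple hnsc r β hβ hfs
  exact not_invariantHeatBathPoincare_of_invariantBottleneck r β hδ A hmeas hinv hmass hflux
    ⟨C, fun S F hF hbd hI => hC S _ rfl F hF hbd hI⟩

end Summit.QuantumFields.YangMills.Theorems.SusceptibilityToPoincare.Negative

end
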